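import Summits.QuantumFields.BalabanUV.T4Continuum.Support.NE9Lemma1RemainderSpeciesAdditive
import Summits.QuantumFields.BalabanUV.T4Continuum.Support.NE9CPieceCouplingModulus

/-!
# NE9RemainderSpeciesCoupling — leaf A3 for the DISPLAYED SPECIES: the per-piece COUPLING response of the owner's species piece
form `RemData.toC` PROVED on the ANALYTIC class, and the END's `hTcup` clause for its channel with a k-uniform constant (cell
`pub-balaban`, T4-DAG §2 node U3 ∕ §6 NE9; NE9 formalisation swarm, unit `b2b-balaban-t4-ne9-formalise-leaf-03` gen 4;
own-initiative micro-item «A3-REM», CLAIMS.log l.9031, at own risk — the A3 analogue of the row owner's S5 theorem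
`NE9Lemma1RemainderSpecies.pieceBoundOnG_rem` p212850; consumer-side socket = leaf-09-g4's (w17) twin
`NE9CPieceCouplingModulus.channelCouplingModulus_cpiece` p212551; v1 = p213083; **v1.0.1 DOCFIX** (self-located on the render of
[II] p. 6, 2026-08-20): binder (d2)'s gloss corrected — 𝐇_k is ANALYTIC, not linear, in g_k ((1.17)∕(1.19)); (d1) gets its
printed locator (p. 6 last ¶); kernel content byte-identical to v1)

HONEST FRAMING (T4-DAG PAGE 1).  Rung (B)+1 of the FINITE-VOLUME T⁴ programme — existence AND uniqueness of the ε → 0 limit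
of gauge-invariant observables on a fixed torus; NOT infinite volume, NOT a mass gap, NOT the Clay problem.  NE9
(`T4OutputRate.NE9` ∧ `FadingMemory`) is a cell NEW ESTIMATE, NOT PRINTED, and is NOT discharged here («NE9 ⇐ the named
binders»); spine 0∕9; 0∕18 skeleton leaves instantiated on Bałaban's objects (O-NE9-1).  HONEST DEPENDENCY (cell line,
verbatim): continuum YM on T⁴ ⇐ BetaPertH ∧ nine spine estimates (0/9 proved); BetaPertH ⇐ (D1) ∧ (D4) ∧ CAP+tail; G-an2-4
gates asym, D1 and NE2/3/4.  Everything below concerns the owner's FORM-level species datum `RemData` ∕ `RemData.toC` on the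
doubled carriers (t4-ne9-p1 g24) and an abstract window family of old terms; [I] = [Balaban1987RG1] (CMP **109**), [II] =
[Balaban1988RG2Cluster] (CMP **116**) are quoted for TYPES only (ABSOLUTE RULE: nothing printed in the audited series is
asserted).  No `def`, no Prop-valued definition (trigger c3: A3's binders stay displayed hypotheses); `FlowStep.BetaPertH`, (B),
(B^μ) do not occur.

WHERE THIS SITS.  The END faces display A3 = `hTcup : |T k g (E g) y − T k g′ (E g) y| ≤ wt k y·(qT k·|g k − g′ k|)` (the channel
read at two coupling ARGUMENTS on the SAME old terms).  On the class-relative piece form it is reduced to ONE per-piece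
COUPLING-RESPONSE bound `hresp` (`channelCouplingModulus_cpiece`, leaf-09-g4; `…_piece`, this lineage p211558).  The owner's
part 2 (p212850) made the DISPLAYED species ([I] (3.34) fifth-order remainder ∕ [II] (1.23)) a class-relative piece form
`D.toC` and PROVED its S5 per-piece bound `pieceBoundOnG_rem` on the ANALYTIC class from `norm_remPiece_le`; this lineage's
`NE9RemainderPieceLinear.norm_remPiece_sub_remPiece_le` (p212900) is the coupling twin of `norm_remPiece_le`.  THIS FILE puts
them together:
* §1 **`cpieceResponse_rem`** — `hresp` for `D.toC` at a window family `E g ∈ analyticClass D.R` with the inductive size (1.18)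
  `TermSize E W κ N` (`0 ≤ N j ≤ Nbar`), from `D.Admissible ℓ c_dir d₀` BY NAME and THREE NEW DISPLAYED A3-BINDERS on the
  contour directions `D.dir` (TYPE [II] (1.17)–(1.21) p. 6–7, (1.23) p. 7, [I] (3.36) p. 277; asserted for nothing of
  Bałaban's): (d1) CONTINUITY on the contours `{|t| = r_k} × {s(Δ) ∈ [0,1], |σ(Δ)| = e^{κ₁}}` (p. 6 last ¶: *"𝐇_k(s(Y₀), B′) is
  an analytic function of s(Y₀), B, for |s(Y₀)| ≦ e^{κ₁} and g_k|B| < ε₁"*); (d2) LIPSCHITZ IN THE k-TH COUPLING there with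
  modulus `clip·(c_dir·ℓ k j·R_X)` — per unit of the direction size (𝐇_k is an ANALYTIC — not linear — function of g_k through
  `B′ = g_kCB − hD̃(g_kCB)` (1.19) and (1.17), with |𝐇_k| ≦ 4B₀C₁e^{16κ₁}g_k|B| (1.21); a g_k-modulus of the size-per-unit-coupling
  type is the Cauchy-estimate reading — PROOF-INTERIOR, asserted nowhere; v1.0.1 corrects v1's gloss «(1.21) is linear in g_k»);
  (d3) DOMAIN INCLUSION WITH ROOM `c_dir·ℓ k j < ½` (`0 < c_dir`, `0 < ℓ`) so that the Cauchy–Lipschitz step runs between the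
  radii R_X∕2 and R_X.
  Constant: `Kp := KpOf D c_dir = 64c_dir⁵∕r_k` (S5's), `gain := ℓ⁵`, **`qc := 64·clip·Nbar`** — k-UNIFORM; four powers of ℓ
  from the remainder, one from the direction's modulus.
* §2 **`channelCouplingModulus_rem`** — the END's `hTcup` for `T := cpieceChannel D.toC` at `E` with the S5 weight
  `weightOf D.toC.frame κ₁ d₀ O1 (KpOf D c_dir)` (the SAME `wt` as `channelSizeAtStepNN_rem`) and **`qT := 64·clip·Nbar·c_Q·(1−ω)⁻¹`**,
  by `channelCouplingModulus_cpiece` BY NAME with the level counts `LevelCountsG D.toC.frame κ κ₁ O1 c_Q (ℓ⁵) (agePow ω)`.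
* §3 non-vacuity of (d2): a direction linear in the k-th coupling meets it (`example`).
So leaf A3 for the displayed species is KERNEL AT FORM LEVEL modulo `D.Admissible`, analyticity + (1.18) of the family,
(d1)–(d3), the counts and scalars — the A3 twin of S5's status after p212850.  NOT TAKEN: the END faces at the species (owner's
part 3), (w16) additivity (leaf-08-g4).  NOT PRINTED and not claimed: that Bałaban's (1.23) pieces, 𝐇_k and inductive spaces
meet these binders (O-NE9-1 ∕ O-NE9-5).  DISGUISE TEST: last coupling only, the SAME old terms at two histories, one species —
no history comparison of terms; not NE9.

WHAT IS PROVED (kernel, `[folklore]`; 0 sorry, 0 `def`): §1 `cpieceResponse_rem`; §2 `channelCouplingModulus_rem`; §3 one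
`example`.  (v1's private copy of `reIm_sub` is kept as a DEPRECATED ALIAS of (w16)'s `NE9Lemma1RemainderSpeciesAdditive.reIm_sub`
— identical statement landed minutes earlier; append-only discipline forbids deleting it.)

References (TYPES only): T. Bałaban, *Renormalization group approach to lattice gauge field theories. II. Cluster expansions*,
Commun. Math. Phys. **116** (1988) 1–22 [Balaban1988RG2Cluster], (1.21)–(1.25) p. 7, (1.26)–(1.29) p. 8, (1.33)–(1.36) p. 9;
T. Bałaban, *Renormalization group approach to lattice gauge field theories. I*, Commun. Math. Phys. **109** (1987) 249–301
[Balaban1987RG1], (0.30) p. 258, (2.12) p. 268, (3.36) p. 277, (3.54) p. 280.  Summits-side NEW work (LEAN PLACEMENT RULE);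
imports leaf-08-g4's (w16) `NE9Lemma1RemainderSpeciesAdditive` (hence this lineage's `NE9RemainderPieceLinear` and the
owner's `NE9Lemma1RemainderSpecies`) and leaf-09-g4's `NE9CPieceCouplingModulus` BY NAME; modifies nothing; no END face re-wired.  Value = a binder reduction (A3 for the displayed
species at form level), NOT summit progress.
-/

noncomputable section

namespace Summit.QuantumFields.BalabanUV.T4Continuum.NE9RemainderSpeciesCoupling

open scoped BigOperators
open Metric Set Complex
open Literature.MathematicalPhysics.QuantumFieldTheory.Balaban1983to89
open Literature.MathematicalPhysics.QuantumFieldTheory.Balaban1983to89.T4OutputRate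
open Literature.MathematicalPhysics.QuantumFieldTheory.Balaban1983to89.T4HistoryLipschitzRecursion
open Literature.MathematicalPhysics.QuantumFieldTheory.Balaban1983to89.T4HistoryLipschitzSegment
open Summit.QuantumFields.BalabanUV.T4Continuum.NE9Lemma1Counting
open Summit.QuantumFields.BalabanUV.T4Continuum.NE9Lemma1Gain
open Summit.QuantumFields.BalabanUV.T4Continuum.NE9Lemma1PieceClass
open Summit.QuantumFields.BalabanUV.T4Continuum.NE9Lemma1RemainderPiece
open Summit.QuantumFields.BalabanUV.T4Continuum.NE9Lemma1RemainderSpecies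
open Summit.QuantumFields.BalabanUV.T4Continuum.NE9RemainderPieceLinear
open Summit.QuantumFields.BalabanUV.T4Continuum.NE9CPieceCouplingModulus
open Summit.QuantumFields.BalabanUV.T4Continuum.NE9ComplexEncoding (doubleCarriers)

variable {C : Carriers} {E : Type} [NormedAddCommGroup E] [NormedSpace ℂ E] {ι α β γ δ : Type} [DecidableEq δ]

/-! ## §1 The per-piece coupling response of the displayed species, PROVED on the analytic class -/

/-- `reIm` is additive: the real ∕ imaginary part of a difference — v1's copy, kept for the append-only discipline as an
ALIAS of (w16)'s `NE9Lemma1RemainderSpeciesAdditive.reIm_sub` (identical statement, landed minutes earlier); use that one.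
[folklore] -/
@[deprecated NE9Lemma1RemainderSpeciesAdditive.reIm_sub (since := "2026-08-20")]
alias reIm_sub := NE9Lemma1RemainderSpeciesAdditive.reIm_sub

/-- **THE PER-PIECE COUPLING RESPONSE OF THE DISPLAYED SPECIES, PROVED ON THE ANALYTIC CLASS (kernel; the theorem of this
leaf — the A3 analogue of the owner's S5 `pieceBoundOnG_rem`).**  Data: the owner's species datum `D` with its displayed binders
`D.Admissible ℓ c_dir d₀` (κ₁ ≥ 1, radii, direction sizes `≤ dirB ≤ c_dir·ℓ·R_X`, source discipline, G1 — BY NAME); a window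
family `E` of old terms ANALYTIC on the balls (`E g ∈ analyticClass D.R`) with the inductive size (1.18) `TermSize E W κ N`,
`0 ≤ N j ≤ Nbar`; and THREE NEW DISPLAYED A3-BINDERS on the contour directions (TYPE [II] (1.17)–(1.21) p. 6–7, (1.23) p. 7,
[I] (3.36) p. 277 — asserted for nothing of Bałaban's): (d1) `hcont` CONTINUITY on the contours (p. 6 last ¶: 𝐇_k(s(Y₀), B′) is
analytic in s(Y₀) for |s(Y₀)| ≦ e^{κ₁}); (d2) `hlip` LIPSCHITZ IN THE k-TH COUPLING on the contours with modulus
`clip·(c_dir·ℓ k j·R_X)` — per unit of the direction size (𝐇_k is an ANALYTIC, not linear, function of g_k through B′ =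
g_kCB − hD̃(g_kCB), (1.17)∕(1.19) p. 6, bounded by *"|𝐇_k(s(Y₀), B′)| ≦ 4B₀C₁e^{16κ₁}g_k|B|"* (1.21); the size-per-unit-coupling
modulus is the Cauchy-estimate reading, PROOF-INTERIOR); (d3) `hhalf` DOMAIN INCLUSION WITH ROOM `c_dir·ℓ k j < ½` (+ `0 < c_dir`,
`0 < ℓ`): the directions stay inside HALF the analyticity radius (the ½ is our normalisation of *"inside"*, not a printed
number).  CONCLUSION: LITERALLY the `hresp` binder of `NE9CPieceCouplingModulus.channelCouplingModulus_cpiece` at `P := D.toC`,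
`Kp := KpOf D c_dir`, `gain := ℓ⁵`, **`qc := 64·clip·Nbar`** (k-uniform).  Proof: `|Re∕Im z − Re∕Im w| ≤ ‖z − w‖`; this lineage's
`norm_remPiece_sub_remPiece_le` between the radii `R_X∕2 < R_X` with `a := c_dir·ℓ·R_X`, `M := 2e^{−κd(X)}N_j` (the size on BOTH
copies of X, `norm_lift_le`), `δ := clip·a·|g k − g′ k|` — constant `(1∕r)·2⁵·(4M∕R)·(R∕2a)·δ·(2a∕R)⁵ = (64c_dir⁵∕r)·(64·clip·N_j)·ℓ⁵·
e^{−κd}·|Δg_k|`; then `B13Sect1Arith.bound_125` under G1.  Four powers of ℓ from the remainder, one from the direction's modulus.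
[cite: Balaban1988RG2Cluster, (1.21)-(1.25) p.7; Balaban1987RG1, (3.36) p.277, (3.54) p.280] -/
theorem cpieceResponse_rem {D : RemData C E ι α β γ δ} {ℓ : ℕ → ℕ → ℝ} {cdir d0 : ℝ} (hD : D.Admissible ℓ cdir d0)
    {Ef : Functional (doubleCarriers C) E} {W : Set (ℕ → ℝ)} {κ : ℝ} {N : ℕ → ℝ} {Nbar clip : ℝ}
    (hE : ∀ g ∈ W, Ef g ∈ analyticClass D.R) (hT : TermSize Ef W κ N) (hN0 : ∀ j, 0 ≤ N j) (hNb : ∀ j, N j ≤ Nbar)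
    (hclip : 0 ≤ clip) (hcdir : 0 < cdir) (hℓ : ∀ k j, 0 < ℓ k j) (hhalf : ∀ k j, cdir * ℓ k j < 1 / 2)
    (hcont : ∀ (k : ℕ) (s : ℕ → ℝ) (y : ι) (a : α) (b : β) (x : (doubleCarriers C).Dom),
      ContinuousOn (fun p : ℂ × ((δ → ℝ) × (δ → ℂ)) => D.dir k s y a b x p.1 p.2.1 p.2.2)
        (sphere (0:ℂ) (D.r k) ×ˢ {q | OnContour D.κ₁ (D.cubes k y a b) q.1 q.2}))
    (hlip : ∀ g ∈ W, ∀ g' ∈ W, ∀ (k : ℕ) (y : ι), ∀ a ∈ D.S0 k y, ∀ b ∈ D.SY k y a, ∀ (j : ℕ), ∀ x ∈ D.src k y a j,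
      ∀ t ∈ sphere (0:ℂ) (D.r k), ∀ (s' : δ → ℝ) (σ' : δ → ℂ), OnContour D.κ₁ (D.cubes k y a b) s' σ' →
        ‖D.dir k g y a b x t s' σ' - D.dir k g' y a b x t s' σ'‖ ≤ clip * (cdir * ℓ k j * D.R x.1) * |g k - g' k|) :
    ∀ g ∈ W, ∀ g' ∈ W, ∀ (k : ℕ) (y : ι), ∀ a ∈ D.toC.S0 k y, ∀ b ∈ D.toC.SY k y a, ∀ (j : ℕ), ∀ x ∈ D.toC.src k y a j,
      |D.toC.piece k g y a b x (Ef g) - D.toC.piece k g' y a b x (Ef g)| ≤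
        KpOf D cdir k y * (64 * clip * Nbar) * ℓ k j ^ 5 * Real.exp (-(κ * (doubleCarriers C).d x)) *
          Real.exp (-(1 / 8) * (D.κ₁ - 1) * D.toC.dY k y + (1 / 8) * D.κ₁ * d0 - (1 / 2) * (D.κ₁ - 1) * D.toC.vol k y a b) *
            |g k - g' k| := by
  intro g hg g' hg' k y a ha b hb j x hx
  -- letters
  set X : C.Dom := x.1 with hXdef
  set l := D.cubes k y a b with hl
  set R : ℝ := D.R X with hRdef
  set a₀ : ℝ := cdir * ℓ k j * R with ha₀
  set M : ℝ := 2 * (Real.exp (-(κ * C.d X)) * N j) with hM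
  set δ₀ : ℝ := clip * a₀ * |g k - g' k| with hδ₀
  have hj : C.scale X = j := hD.srcScale k y a j x hx
  have hRpos : 0 < R := hD.R_pos X
  have ha₀pos : 0 < a₀ := by rw [ha₀]; exact mul_pos (mul_pos hcdir (hℓ k j)) hRpos
  have ha₀R' : a₀ < R / 2 := by
    have := hhalf k j
    rw [ha₀]; nlinarith
  have hR'R : R / 2 < R := by linarith
  have hδ₀0 : 0 ≤ δ₀ := by rw [hδ₀]; exact mul_nonneg (mul_nonneg hclip ha₀pos.le) (abs_nonneg _)
  -- the size of the complex old term on the ball, from (1.18) on both copies of X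
  have hMbd : ∀ z ∈ ball (0 : E) R, ‖lift (Ef g) X z‖ ≤ M := by
    intro z _
    have h1 := hT g hg z (X, true)
    have h2 := hT g hg z (X, false)
    have hsc : (doubleCarriers C).scale (X, true) = j := hj
    have hsc' : (doubleCarriers C).scale (X, false) = j := hj
    rw [hsc] at h1; rw [hsc'] at h2
    exact norm_lift_le h1 h2
  -- the direction maps at the two histories: continuous, bounded by a₀, at distance ≤ δ₀ on the contours
  have hdirB : ∀ s : ℕ → ℝ, D.dirB k s y a b x ≤ a₀ := fun s => by
    rw [ha₀]; exact hD.dirB_le k s y a ha b hb j x hx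
  have hA : ∀ s : ℕ → ℝ, ∀ t ∈ sphere (0:ℂ) (D.r k), ∀ s' σ',
      (∀ i ∈ l, s' i ∈ Icc (0:ℝ) 1 ∧ σ' i ∈ sphere (0:ℂ) (Real.exp D.κ₁)) → ‖D.dir k s y a b x t s' σ'‖ ≤ a₀ :=
    fun s t ht s' σ' hsσ => (hD.dir_le k s y a b x t ht s' σ' hsσ).trans (hdirB s)
  have hAA' : ∀ t ∈ sphere (0:ℂ) (D.r k), ∀ s' σ',
      (∀ i ∈ l, s' i ∈ Icc (0:ℝ) 1 ∧ σ' i ∈ sphere (0:ℂ) (Real.exp D.κ₁)) →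
        ‖D.dir k g y a b x t s' σ' - D.dir k g' y a b x t s' σ'‖ ≤ δ₀ := by
    intro t ht s' σ' hsσ
    have h := hlip g hg g' hg' k y a ha b hb j x hx t ht s' σ' hsσ
    rw [hδ₀, ha₀]; exact h
  -- the closed-form coupling response of the (1.23)-functional (this lineage's `norm_remPiece_sub_remPiece_le`)
  have hrem := norm_remPiece_sub_remPiece_le (n := 5) hD.κ₁_ge (hD.r_pos k) (hE g hg X) hMbd ha₀pos ha₀R' hR'R hδ₀0 l
    (D.dir k g y a b x) (D.dir k g' y a b x) (hcont k g y a b x) (hcont k g' y a b x) (hA g) (hA g') hAA' _ _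
    (onContour_base D.κ₁ l)
  -- (1.25)
  have h125 := B13Sect1Arith.bound_125 (N := (l.length : ℝ)) (dY := D.dY k y) hD.κ₁_ge hD.d0_nonneg
    (hD.G1 k y a ha b hb)
  have hM0 : 0 ≤ M := by rw [hM]; exact mul_nonneg zero_le_two (mul_nonneg (Real.exp_pos _).le (hN0 j))
  have hr0 : 0 < D.r k := hD.r_pos k
  -- assemble
  show |reIm x.2 (remPiece (Real.exp D.κ₁) (D.r k) (D.cubes k y a b) (lift (Ef g) x.1) 5 (D.dir k g y a b x)
      (fun _ => (0:ℝ)) (fun _ => ((Real.exp D.κ₁ : ℝ) : ℂ))) -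
      reIm x.2 (remPiece (Real.exp D.κ₁) (D.r k) (D.cubes k y a b) (lift (Ef g) x.1) 5 (D.dir k g' y a b x)
      (fun _ => (0:ℝ)) (fun _ => ((Real.exp D.κ₁ : ℝ) : ℂ)))| ≤ KpOf D cdir k y * (64 * clip * Nbar) * ℓ k j ^ 5 *
        Real.exp (-(κ * (doubleCarriers C).d x)) *
          Real.exp (-(1 / 8) * (D.κ₁ - 1) * D.toC.dY k y + (1 / 8) * D.κ₁ * d0 -
            (1 / 2) * (D.κ₁ - 1) * D.toC.vol k y a b) * |g k - g' k|
  have hdx : (doubleCarriers C).d x = C.d X := rfl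
  have hdY : D.toC.dY k y = D.dY k y := rfl
  have hvol : D.toC.vol k y a b = (l.length : ℝ) := rfl
  rw [hdx, hdY, hvol, ← hXdef, ← hl, ← NE9Lemma1RemainderSpeciesAdditive.reIm_sub]
  -- the constant of `hrem`, simplified: (1/r)·(2⁵·(2M/(R − R/2))·((R/2)/a₀)·δ₀)·(a₀/(R/2))⁵ = (1/r)·2048·M·clip·|Δg|·(cdir ℓ)⁵
  have hconst : 1 / D.r k * (2 ^ 5 * (2 * M / (R - R / 2) * (R / 2 / a₀) * δ₀) * (a₀ / (R / 2)) ^ 5) =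
      1 / D.r k * (2048 * M * clip * (cdir * ℓ k j) ^ 5) * |g k - g' k| := by
    rw [hδ₀, ha₀]
    field_simp
    ring
  have hNj : M ≤ 2 * (Real.exp (-(κ * C.d X)) * Nbar) := by
    rw [hM]; exact mul_le_mul_of_nonneg_left (mul_le_mul_of_nonneg_left (hNb j) (Real.exp_pos _).le) zero_le_two
  have hcl : 0 ≤ (cdir * ℓ k j) ^ 5 := pow_nonneg (mul_nonneg hcdir.le (hℓ k j).le) 5
  calc |reIm x.2 (remPiece (Real.exp D.κ₁) (D.r k) l (lift (Ef g) X) 5 (D.dir k g y a b x) (fun _ => (0:ℝ))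
            (fun _ => ((Real.exp D.κ₁ : ℝ) : ℂ)) -
          remPiece (Real.exp D.κ₁) (D.r k) l (lift (Ef g) X) 5 (D.dir k g' y a b x) (fun _ => (0:ℝ))
            (fun _ => ((Real.exp D.κ₁ : ℝ) : ℂ)))|
        ≤ ‖remPiece (Real.exp D.κ₁) (D.r k) l (lift (Ef g) X) 5 (D.dir k g y a b x) (fun _ => (0:ℝ))
            (fun _ => ((Real.exp D.κ₁ : ℝ) : ℂ)) -
          remPiece (Real.exp D.κ₁) (D.r k) l (lift (Ef g) X) 5 (D.dir k g' y a b x) (fun _ => (0:ℝ))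
            (fun _ => ((Real.exp D.κ₁ : ℝ) : ℂ))‖ := abs_reIm_le _ _
    _ ≤ 1 / D.r k * (2 ^ 5 * (2 * M / (R - R / 2) * (R / 2 / a₀) * δ₀) * (a₀ / (R / 2)) ^ 5) *
          Real.exp (-(D.κ₁ - 1) * l.length) := hrem
    _ = 1 / D.r k * (2048 * M * clip * (cdir * ℓ k j) ^ 5) * |g k - g' k| * Real.exp (-(D.κ₁ - 1) * l.length) := by
        rw [hconst]
    _ ≤ 1 / D.r k * (2048 * (2 * (Real.exp (-(κ * C.d X)) * Nbar)) * clip * (cdir * ℓ k j) ^ 5) * |g k - g' k| *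
          Real.exp (-(1 / 8) * (D.κ₁ - 1) * D.dY k y + (1 / 8) * D.κ₁ * d0 - (1 / 2) * (D.κ₁ - 1) * l.length) := by
        refine mul_le_mul ?_ h125 (Real.exp_pos _).le ?_
        · refine mul_le_mul_of_nonneg_right (mul_le_mul_of_nonneg_left ?_ (div_pos one_pos hr0).le) (abs_nonneg _)
          exact mul_le_mul_of_nonneg_right (mul_le_mul_of_nonneg_right
            (mul_le_mul_of_nonneg_left hNj (by norm_num)) hclip) hcl
        · have : 0 ≤ Real.exp (-(κ * C.d X)) * Nbar := mul_nonneg (Real.exp_pos _).le ((hN0 j).trans (hNb j))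
          exact mul_nonneg (mul_nonneg (div_pos one_pos hr0).le (by positivity)) (abs_nonneg _)
    _ = KpOf D cdir k y * (64 * clip * Nbar) * ℓ k j ^ 5 * Real.exp (-(κ * C.d X)) *
          Real.exp (-(1 / 8) * (D.κ₁ - 1) * D.dY k y + (1 / 8) * D.κ₁ * d0 - (1 / 2) * (D.κ₁ - 1) * l.length) *
            |g k - g' k| := by
        simp only [KpOf]; ring

/-! ## §2 Leaf A3 (`hTcup`) for the displayed species' channel -/

/-- **LEAF A3 FOR THE DISPLAYED SPECIES ON THE ANALYTIC CLASS (kernel).**  The END's channel-coupling-modulus clause `hTcup` for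
`T := cpieceChannel D.toC` read at the window family `E`: `|T k g (E g) y − T k g′ (E g) y| ≤ wt k y·(qT·|g k − g′ k|)` with the
S5 weight `wt := weightOf D.toC.frame κ₁ d₀ O1 (KpOf D c_dir)` (the SAME weight as the owner's `channelSizeAtStepNN_rem`) and the
k-UNIFORM constant **`qT := 64·clip·Nbar·c_Q·(1 − ω)⁻¹`** — leaf-09-g4's `channelCouplingModulus_cpiece` BY NAME fed with §1 and
the level counts `LevelCountsG D.toC.frame κ κ₁ O1 c_Q (ℓ⁵) (agePow ω)` ([II] p. 8, the (0.30) profile).  Displayed after this: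
`D.Admissible`, analyticity + (1.18) of the family, (d1)–(d3), the counts, scalars.  NOT PRINTED, not claimed: that Bałaban's
(1.23) pieces and 𝐇_k meet these binders (O-NE9-1 ∕ O-NE9-5). [cite: Balaban1988RG2Cluster, (1.21)-(1.29) pp.7-8, (1.33)-(1.36)
p.9; Balaban1987RG1, (0.30) p.258, (2.12) p.268] -/
theorem channelCouplingModulus_rem {D : RemData C E ι α β γ δ} {ℓ : ℕ → ℕ → ℝ} {cdir d0 : ℝ} (hD : D.Admissible ℓ cdir d0)
    {Ef : Functional (doubleCarriers C) E} {W : Set (ℕ → ℝ)} {κ : ℝ} {N : ℕ → ℝ} {Nbar clip : ℝ}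
    (hE : ∀ g ∈ W, Ef g ∈ analyticClass D.R) (hT : TermSize Ef W κ N) (hN0 : ∀ j, 0 ≤ N j) (hNb : ∀ j, N j ≤ Nbar)
    (hclip : 0 ≤ clip) (hcdir : 0 < cdir) (hℓ : ∀ k j, 0 < ℓ k j) (hhalf : ∀ k j, cdir * ℓ k j < 1 / 2)
    (hcont : ∀ (k : ℕ) (s : ℕ → ℝ) (y : ι) (a : α) (b : β) (x : (doubleCarriers C).Dom),
      ContinuousOn (fun p : ℂ × ((δ → ℝ) × (δ → ℂ)) => D.dir k s y a b x p.1 p.2.1 p.2.2)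
        (sphere (0:ℂ) (D.r k) ×ˢ {q | OnContour D.κ₁ (D.cubes k y a b) q.1 q.2}))
    (hlip : ∀ g ∈ W, ∀ g' ∈ W, ∀ (k : ℕ) (y : ι), ∀ a ∈ D.S0 k y, ∀ b ∈ D.SY k y a, ∀ (j : ℕ), ∀ x ∈ D.src k y a j,
      ∀ t ∈ sphere (0:ℂ) (D.r k), ∀ (s' : δ → ℝ) (σ' : δ → ℂ), OnContour D.κ₁ (D.cubes k y a b) s' σ' →
        ‖D.dir k g y a b x t s' σ' - D.dir k g' y a b x t s' σ'‖ ≤ clip * (cdir * ℓ k j * D.R x.1) * |g k - g' k|)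
    {O1 cQ ω : ℝ} (hL : LevelCountsG D.toC.frame κ D.κ₁ O1 cQ (fun k j => ℓ k j ^ 5) (agePow ω)) (hO1 : 0 ≤ O1)
    (hcQ : 0 ≤ cQ) (hω0 : 0 ≤ ω) (hω1 : ω < 1) :
    ∀ g ∈ W, ∀ g' ∈ W, ∀ (k : ℕ) (y : ι),
      |cpieceChannel D.toC k g (Ef g) y - cpieceChannel D.toC k g' (Ef g) y| ≤
        weightOf D.toC.frame D.κ₁ d0 O1 (KpOf D cdir) k y * (64 * clip * Nbar * cQ * (1 - ω)⁻¹ * |g k - g' k|) :=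
  channelCouplingModulus_cpiece D.toC (cpieceResponse_rem hD hE hT hN0 hNb hclip hcdir hℓ hhalf hcont hlip) hL
    (kpOf_nonneg hD) (mul_nonneg (mul_nonneg (by norm_num) hclip) ((hN0 0).trans (hNb 0))) hO1
    (fun k j => pow_nonneg (hℓ k j).le 5) hcQ hω0 hω1

/-! ## §3 Non-vacuity of the new binder (d2) -/

omit [DecidableEq δ] in
/-- A direction LINEAR in the k-th coupling — `dir(s) := s k • B(t, s′, σ′)` (a caricature only: the printed 𝐇_k is analytic,
not linear, in g_k — (1.17)∕(1.19) p. 6) — is Lipschitz in that coupling with modulus the size of `B`: binder (d2) is met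
whenever ‖B‖ ≤ c_dir·ℓ·R on the contours (with `clip = 1`). [folklore] -/
example (B : ℂ → (δ → ℝ) → (δ → ℂ) → E) {c : ℝ} (hB : ∀ t s' σ', ‖B t s' σ'‖ ≤ c) (g g' : ℕ → ℝ) (k : ℕ)
    (t : ℂ) (s' : δ → ℝ) (σ' : δ → ℂ) :
    ‖(g k : ℂ) • B t s' σ' - (g' k : ℂ) • B t s' σ'‖ ≤ 1 * c * |g k - g' k| := by
  rw [← sub_smul, norm_smul, ← Complex.ofReal_sub, Complex.norm_real, Real.norm_eq_abs, one_mul, mul_comm]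
  exact mul_le_mul_of_nonneg_right (hB t s' σ') (abs_nonneg _)

end Summit.QuantumFields.BalabanUV.T4Continuum.NE9RemainderSpeciesCoupling

end
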